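import Summits.QuantumFields.YangMills.Theorems.PoincareLipschitzLeungXinGraphStability
import Literature.MathematicalPhysics.QuantumFieldTheory.Balaban1983to89.B4Eq19LatticeCaccioppoli
import HarnessLib

/-!
# Crux `HistoryTailL` (stmt-QuantumFields-19936), K2 organ of record `hReg` = «LOC-REG-MIN» (route crux `PoincareLipschitz.BlockLipschitzL`,
# stmt-QuantumFields-23533): THE STABILITY CACCIOPPOLI INEQUALITY ON BOXES OF `ℤ^d` — the box cutoff and the bond count that turn LEAD's
# ✓`graph_stability` into the absolute local energy bound `E(Q_ρ) ≤ 3·2d(2(ρ+s)+1)^d ∕ s²` (`≍ R^{d−2}` at `ρ = s = R`) from minimality alone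

Cell `ym3-torus` (YM ladder rung R3 = continuum SU(2) Yang–Mills on the three-torus — a RUNG, NOT the Clay problem: not d = 4, not infinite
volume, not a mass gap), TWIN-WIDTH seat `ym-ust-19936-w7` gen 11 (LEAD `ym-ust-19936-w1` g8 DISPATCH 2026-08-29T04:55:44Z «★w7 g11: BOX CUTOFF +
TWIST SIZE — GO»); `--supports stmt-QuantumFields-19936 --as helper`; THEOREMS ONLY, definition-free; carrier `Zd d = Fin d → ℤ` (the lattice
regularity files' convention, lit ✓`B4Eq19Lattice*`; the torus-box transfer belongs to the knit), every `d`.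

WHY.  LEAD's ✓`PoincareLipschitzLeungXinGraphStability.graph_stability` is the FLAT stability (Leung–Xin ∕ Kajigaya) inequality on an abstract finite
graph: for `u : V → S³ ⊂ ℝ⁴`, minimality of the Dirichlet energy along the four conformal curves, weighted by ANY vertex cutoff `η`, gives
`Σ_b η_xη_y·e_b·(1 + e_b∕2) ≤ 3·Σ_b c_b·(η_x − η_y)²` (`e_b = |u_x − u_y|²`, `c_b = u_x·u_y`).  The located «remaining brick» (LEAD 04:51:59Z) between
this and the tower is the CHOICE OF `η` and the COUNT: on `ℤ^d`, with lit ✓`B4Eq19LatticeCaccioppoli.exists_cutoff` (`χ = 1` on `Q_{ρ+1}(z)`, `χ = 0`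
off `Q_{ρ+s}(z)`, `|χ(y + e_μ) − χ(y)| ≤ 1∕s`, `0 ≤ χ ≤ 1`), the right side is at most `3·#{bonds touching Q_{ρ+s}(z)}∕s² ≤ 3·2d(2(ρ+s)+1)^d∕s²`
(`c_b ≤ 1` by Cauchy–Schwarz; bonds with both ends off `Q_{ρ+s}` contribute `0`), and the left side dominates the energy of the bonds inside
`Q_ρ(z)` (where `χ_xχ_y = 1`).  So (`stability_caccioppoli_box`): for ANY finite bond set `T` (the consumer's region; a bond is `(y, μ) : y → y + e_μ`)
and any unit `u` whose twisted-free correlation `Σ_{b∈T} u_x·u_y` is not increased by the Leung–Xin variations with cutoffs SUPPORTED IN `Q_{ρ+s}(z)`,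

  `Σ_{b ∈ T, both ends in Q_ρ(z)} e_b·(1 + e_b∕2) ≤ 3·(2d·(2(ρ+s)+1)^d)∕s²`

— at `ρ = s = R`: `E(Q_R) ≤ 6d(4R+1)^d∕R² ≍ R^{d−2}`, the absolute local energy bound of a box-stable sphere map FROM STABILITY ALONE (normalised energy
BOUNDED, not small).  The hypothesis is what box-ℓ²-orbit minimality of the relative gauge `h` (global on the region, or local with free set
`⊇ Q_{ρ+s}(z)`) gives through LEAD's ✓∕⧗`PoincareLipschitzSU2SphereDictionary` (`dist1_bond_sq_eq`, `exists_su2_coords_eq`: the varied unit vectors ARE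
gauge transformations, and `η = 0` off the box leaves `h` unchanged there) — for EVERY admissible `η` at once, so the consumer never names the cutoff.
The TWISTED form (bond transports `S_b`, `+ 6Σ η_xη_y‖S_b − 1‖_F²`, over ★w8-19936 g6's `twisted_graph_stability_frob`) is the sequel (same cutoff,
same count, `‖S_b − 1‖_F² ≤ 8(dist1 V_b² + dist1 W_b²)` by the dictionary's `exists_orthogonal_twist`).

WHAT (ns `…Theorems.PoincareLipschitzLeungXinBoxCaccioppoli`; letters of ✓`graph_stability`: `Fin 4 → ℝ`, `dotProduct`, `e_a = Pi.single a 1`).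
* §1 `dot_le_one` (Cauchy–Schwarz for unit vectors), `sq_sub_le_of_cutoff`, `card_filter_fst_mem_box_le`, `card_filter_snd_mem_box_le`,
  ★`card_touching_box_le` (`#{b ∈ T : b touches Q_R(z)} ≤ 2d(2R+1)^d`), `sum_sq_sub_cutoff_le` (the capacity of the lattice cutoff over any bond set).
* §2 ★★★`stability_caccioppoli_box` (displayed above), ★★`stability_caccioppoli_box_half` (`ρ = s = R`: `≤ 6d(4R+1)^d ∕ R²`).
HONEST SCOPE.  An instantiation (cutoff + counting) of LEAD's inequality; nothing of `hReg`∕LOC-REG-MIN, the charts, `BlockLipschitzL`, `HistoryTailL` or any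
summit statement is proved; the energy→range step (discrete ε-regularity) is NOT here.  YM₃ on T³ is rung R3, NOT the Clay problem.

References: Y. L. Xin, Duke Math. J. **47** (1980) 609–613 [Xin1980]; T. Kajigaya, Ann. Mat. Pura Appl. (2023) doi:10.1007∕s10231-023-01374-3, Thm 1.2,
(2.9)–(2.10); M. Giaquinta, *Multiple integrals in the calculus of variations and nonlinear elliptic systems* (1983) [Giaquinta1984] Ch. III §2 p.77
(the cutoff); R. Schoen, K. Uhlenbeck, J. Differential Geom. **17** (1982) 307–335; T. Bałaban, Commun. Math. Phys. **98** (1985) 17–51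
[Balaban1985Averaging] §3.
-/

set_option autoImplicit false

open scoped BigOperators
open Finset Matrix

namespace Summit.QuantumFields.YangMills.Theorems.PoincareLipschitzLeungXinBoxCaccioppoli

open Literature.MathematicalPhysics.QuantumFieldTheory.Balaban1983to89.B4Eq19LatticeOperators
  (Zd unitVec box mem_box box_mono card_box)
open Literature.MathematicalPhysics.QuantumFieldTheory.Balaban1983to89.B4Eq19LatticeCaccioppoli (exists_cutoff)
open Summit.QuantumFields.YangMills.Theorems.PoincareLipschitzLeungXinGraphStability (graph_stability)

variable {d : ℕ}

/-! ## §1 Letters: Cauchy–Schwarz on the sphere, the cutoff's bond capacity, the count of bonds touching a box -/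

/-- Cauchy–Schwarz for unit vectors of `ℝ⁴`: `u·v ≤ 1` (from `0 ≤ |u − v|² = 2 − 2u·v`). [folklore] -/
theorem dot_le_one {u v : Fin 4 → ℝ} (hu : dotProduct u u = 1) (hv : dotProduct v v = 1) : dotProduct u v ≤ 1 := by
  have h0 : 0 ≤ dotProduct (u - v) (u - v) := by
    simp only [dotProduct, Pi.sub_apply]
    exact Finset.sum_nonneg fun i _ => mul_self_nonneg _
  have h1 : dotProduct (u - v) (u - v) = 2 - 2 * dotProduct u v := by
    rw [sub_dotProduct, dotProduct_sub, dotProduct_sub, hu, hv, dotProduct_comm v u]; ring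
  linarith

/-- The capacity of one bond under a lattice cutoff: `|χ(y + e_μ) − χ(y)| ≤ 1∕s` gives `(χ y − χ(y + e_μ))² ≤ 1∕s²`. [folklore] -/
theorem sq_sub_le_of_cutoff {χ : Zd d → ℝ} {s : ℤ} (hs : 1 ≤ s)
    (hlip : ∀ (y : Zd d) (μ : Fin d), |χ (y + unitVec μ) - χ y| ≤ 1 / s) (y : Zd d) (μ : Fin d) :
    (χ y - χ (y + unitVec μ)) ^ 2 ≤ 1 / (s : ℝ) ^ 2 := by
  have h := hlip y μ
  have hs0 : (0 : ℝ) < s := by exact_mod_cast (show (0 : ℤ) < s by omega)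
  have h1 : |χ y - χ (y + unitVec μ)| ≤ 1 / s := by rw [abs_sub_comm]; exact h
  have h2 : (χ y - χ (y + unitVec μ)) ^ 2 = |χ y - χ (y + unitVec μ)| ^ 2 := (sq_abs _).symm
  rw [h2, show (1 : ℝ) / (s : ℝ) ^ 2 = (1 / s) ^ 2 by rw [div_pow, one_pow]]
  exact pow_le_pow_left₀ (abs_nonneg _) h1 2

/-- Bonds of `T` whose SOURCE lies in `Q_R(z)` are at most `d·#Q_R(z)` (they inject into `Q_R(z) × Fin d`). [folklore] -/
theorem card_filter_fst_mem_box_le (T : Finset (Zd d × Fin d)) (z : Zd d) (R : ℤ) :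
    (T.filter fun b => b.1 ∈ box z R).card ≤ (box z R).card * d := by
  classical
  calc (T.filter fun b => b.1 ∈ box z R).card ≤ ((box z R) ×ˢ (Finset.univ : Finset (Fin d))).card := by
        refine Finset.card_le_card fun b hb => ?_
        rw [Finset.mem_filter] at hb
        exact Finset.mem_product.2 ⟨hb.2, Finset.mem_univ _⟩
    _ = (box z R).card * d := by rw [Finset.card_product, Finset.card_univ, Fintype.card_fin]

/-- Bonds of `T` whose TARGET lies in `Q_R(z)` are at most `d·#Q_R(z)` (`(y, μ) ↦ (y + e_μ, μ)` is injective into `Q_R(z) × Fin d`). [folklore] -/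
theorem card_filter_snd_mem_box_le (T : Finset (Zd d × Fin d)) (z : Zd d) (R : ℤ) :
    (T.filter fun b => b.1 + unitVec b.2 ∈ box z R).card ≤ (box z R).card * d := by
  classical
  calc (T.filter fun b => b.1 + unitVec b.2 ∈ box z R).card ≤ ((box z R) ×ˢ (Finset.univ : Finset (Fin d))).card := by
        refine Finset.card_le_card_of_injOn (fun b => (b.1 + unitVec b.2, b.2)) (fun b hb => ?_) ?_
        · rw [Finset.mem_coe, Finset.mem_filter] at hb
          exact Finset.mem_coe.2 (Finset.mem_product.2 ⟨hb.2, Finset.mem_univ _⟩)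
        · intro b _ b' _ h
          simp only [Prod.mk.injEq] at h
          obtain ⟨h1, h2⟩ := h
          rw [h2] at h1
          exact Prod.ext (add_right_cancel h1) h2
    _ = (box z R).card * d := by rw [Finset.card_product, Finset.card_univ, Fintype.card_fin]

/-- ★ **The count of bonds touching a box**: in any finite bond set `T` of `ℤ^d` (bond `(y, μ) : y → y + e_μ`, no repetitions) the bonds with an
endpoint in `Q_R(z)` (`R ≥ 0`) number at most `2d·(2R+1)^d`. [folklore] -/
theorem card_touching_box_le (T : Finset (Zd d × Fin d)) (z : Zd d) {R : ℤ} (hR : 0 ≤ R) :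
    ((T.filter fun b => b.1 ∈ box z R ∨ b.1 + unitVec b.2 ∈ box z R).card : ℝ) ≤
      2 * (d : ℝ) * ((2 * R + 1 : ℤ) : ℝ) ^ d := by
  classical
  have hsub : (T.filter fun b => b.1 ∈ box z R ∨ b.1 + unitVec b.2 ∈ box z R) ⊆
      (T.filter fun b => b.1 ∈ box z R) ∪ (T.filter fun b => b.1 + unitVec b.2 ∈ box z R) := by
    intro b hb
    rw [Finset.mem_filter] at hb
    rw [Finset.mem_union, Finset.mem_filter, Finset.mem_filter]
    rcases hb.2 with h | h
    · exact Or.inl ⟨hb.1, h⟩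
    · exact Or.inr ⟨hb.1, h⟩
  have h1 := card_filter_fst_mem_box_le T z R
  have h2 := card_filter_snd_mem_box_le T z R
  have hcard : (T.filter fun b => b.1 ∈ box z R ∨ b.1 + unitVec b.2 ∈ box z R).card ≤ 2 * ((box z R).card * d) :=
    (Finset.card_le_card hsub).trans ((Finset.card_union_le _ _).trans (by omega))
  have hcast : ((T.filter fun b => b.1 ∈ box z R ∨ b.1 + unitVec b.2 ∈ box z R).card : ℝ) ≤ 2 * (((box z R).card : ℝ) * d) := by
    exact_mod_cast hcard
  rw [card_box z hR] at hcast
  linarith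

/-- **The capacity of the lattice cutoff over a bond set**: for `χ` vanishing off `Q_R(z)` with `|χ(y+e_μ) − χ(y)| ≤ 1∕s` and bond weights `w_b ≤ 1`,
`Σ_{b∈T} w_b·(χ_x − χ_y)² ≤ 2d(2R+1)^d ∕ s²` — only bonds touching `Q_R(z)` contribute. [folklore] [cite: Giaquinta1984, Ch. III §2 p.77] -/
theorem sum_sq_sub_cutoff_le (T : Finset (Zd d × Fin d)) (z : Zd d) {R s : ℤ} (hR : 0 ≤ R) (hs : 1 ≤ s)
    {χ : Zd d → ℝ} (hout : ∀ y ∉ box z R, χ y = 0) (hlip : ∀ (y : Zd d) (μ : Fin d), |χ (y + unitVec μ) - χ y| ≤ 1 / s)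
    (w : Zd d × Fin d → ℝ) (hw : ∀ b ∈ T, w b ≤ 1) :
    ∑ b ∈ T, w b * (χ b.1 - χ (b.1 + unitVec b.2)) ^ 2 ≤ 2 * (d : ℝ) * ((2 * R + 1 : ℤ) : ℝ) ^ d / (s : ℝ) ^ 2 := by
  classical
  have hs0 : (0 : ℝ) < (s : ℝ) ^ 2 := by
    have : (0 : ℝ) < s := by exact_mod_cast (show (0 : ℤ) < s by omega)
    positivity
  -- split `T` into the bonds touching the box and the rest (which contribute `0`)
  rw [← Finset.sum_filter_add_sum_filter_not T (fun b => b.1 ∈ box z R ∨ b.1 + unitVec b.2 ∈ box z R)]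
  have hzero : ∑ b ∈ T.filter (fun b => ¬(b.1 ∈ box z R ∨ b.1 + unitVec b.2 ∈ box z R)),
      w b * (χ b.1 - χ (b.1 + unitVec b.2)) ^ 2 = 0 := by
    refine Finset.sum_eq_zero fun b hb => ?_
    rw [Finset.mem_filter, not_or] at hb
    rw [hout _ hb.2.1, hout _ hb.2.2, sub_zero, zero_pow two_ne_zero, mul_zero]
  rw [hzero, add_zero]
  -- each touching bond contributes at most `1∕s²`
  have hterm : ∀ b ∈ T.filter (fun b => b.1 ∈ box z R ∨ b.1 + unitVec b.2 ∈ box z R),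
      w b * (χ b.1 - χ (b.1 + unitVec b.2)) ^ 2 ≤ 1 / (s : ℝ) ^ 2 := by
    intro b hb
    have hb' := (Finset.mem_filter.1 hb).1
    have hsq := sq_sub_le_of_cutoff hs hlip b.1 b.2
    calc w b * (χ b.1 - χ (b.1 + unitVec b.2)) ^ 2 ≤ 1 * (χ b.1 - χ (b.1 + unitVec b.2)) ^ 2 :=
          mul_le_mul_of_nonneg_right (hw b hb') (sq_nonneg _)
      _ ≤ 1 / (s : ℝ) ^ 2 := by rw [one_mul]; exact hsq
  calc ∑ b ∈ T.filter (fun b => b.1 ∈ box z R ∨ b.1 + unitVec b.2 ∈ box z R), w b * (χ b.1 - χ (b.1 + unitVec b.2)) ^ 2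
      ≤ ∑ _b ∈ T.filter (fun b => b.1 ∈ box z R ∨ b.1 + unitVec b.2 ∈ box z R), 1 / (s : ℝ) ^ 2 := Finset.sum_le_sum hterm
    _ = ((T.filter fun b => b.1 ∈ box z R ∨ b.1 + unitVec b.2 ∈ box z R).card : ℝ) * (1 / (s : ℝ) ^ 2) := by
        rw [Finset.sum_const, nsmul_eq_mul]
    _ ≤ (2 * (d : ℝ) * ((2 * R + 1 : ℤ) : ℝ) ^ d) * (1 / (s : ℝ) ^ 2) :=
        mul_le_mul_of_nonneg_right (card_touching_box_le T z hR) (by positivity)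
    _ = 2 * (d : ℝ) * ((2 * R + 1 : ℤ) : ℝ) ^ d / (s : ℝ) ^ 2 := by ring

/-! ## §2 The stability Caccioppoli inequality on a box of `ℤ^d` -/

/-- ★★★ **THE STABILITY CACCIOPPOLI INEQUALITY ON A BOX OF `ℤ^d` (flat).**  Let `T` be any finite set of lattice bonds (`(y, μ) : y → y + e_μ`),
`u : ℤ^d → S³ ⊂ ℝ⁴` (unit vectors), `z ∈ ℤ^d`, `ρ ≥ 0`, `s ≥ 1`.  Suppose that for EVERY vertex cutoff `η` supported in `Q_{ρ+s}(z)`, each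
coordinate field `a` and every `t ∈ ℝ`, the Leung–Xin-varied map `U_t^{a,η}` (✓`graph_stability`'s, verbatim) does not increase the correlation:
`Σ_{b∈T} U_t^{a,η}(x)·U_t^{a,η}(y) ≤ Σ_{b∈T} u_x·u_y` (energy-minimality of `u` on `T` against variations supported in the box).  Then the energy of the
bonds of `T` inside `Q_ρ(z)` obeys `Σ e_b·(1 + e_b∕2) ≤ 3·(2d·(2(ρ+s)+1)^d)∕s²`, `e_b = |u_x − u_y|²` — `≍ R^{d−2}` at `ρ = s = R`: normalised energy
BOUNDED from stability alone (✓`graph_stability` at lit ✓`exists_cutoff`'s `χ`; `c_b ≤ 1`; bond count `card_touching_box_le`).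
[cite: Xin1980, p.609–613; Kajigaya 2023 Thm 1.2; Giaquinta1984, Ch. III §2 p.77] -/
theorem stability_caccioppoli_box (T : Finset (Zd d × Fin d)) (u : Zd d → Fin 4 → ℝ) (hu : ∀ x, dotProduct (u x) (u x) = 1)
    (z : Zd d) {ρ s : ℤ} (hρ : 0 ≤ ρ) (hs : 1 ≤ s)
    (hmin : ∀ η : Zd d → ℝ, (∀ y ∉ box z (ρ + s), η y = 0) → ∀ (a : Fin 4) (t : ℝ),
      ∑ b ∈ T, dotProduct
        ((Real.sqrt (1 + t ^ 2 * dotProduct (η b.1 • (Pi.single a 1 - dotProduct (Pi.single a 1) (u b.1) • u b.1))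
            (η b.1 • (Pi.single a 1 - dotProduct (Pi.single a 1) (u b.1) • u b.1))))⁻¹ •
          (u b.1 + t • (η b.1 • (Pi.single a 1 - dotProduct (Pi.single a 1) (u b.1) • u b.1))))
        ((Real.sqrt (1 + t ^ 2 * dotProduct (η (b.1 + unitVec b.2) •
              (Pi.single a 1 - dotProduct (Pi.single a 1) (u (b.1 + unitVec b.2)) • u (b.1 + unitVec b.2)))
            (η (b.1 + unitVec b.2) • (Pi.single a 1 - dotProduct (Pi.single a 1) (u (b.1 + unitVec b.2)) • u (b.1 + unitVec b.2)))))⁻¹ •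
          (u (b.1 + unitVec b.2) + t • (η (b.1 + unitVec b.2) •
            (Pi.single a 1 - dotProduct (Pi.single a 1) (u (b.1 + unitVec b.2)) • u (b.1 + unitVec b.2))))) ≤
      ∑ b ∈ T, dotProduct (u b.1) (u (b.1 + unitVec b.2))) :
    ∑ b ∈ T.filter (fun b => b.1 ∈ box z ρ ∧ b.1 + unitVec b.2 ∈ box z ρ),
      dotProduct (u b.1 - u (b.1 + unitVec b.2)) (u b.1 - u (b.1 + unitVec b.2)) *
        (1 + dotProduct (u b.1 - u (b.1 + unitVec b.2)) (u b.1 - u (b.1 + unitVec b.2)) / 2) ≤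
      3 * (2 * (d : ℝ) * ((2 * (ρ + s) + 1 : ℤ) : ℝ) ^ d) / (s : ℝ) ^ 2 := by
  classical
  obtain ⟨χ, hχ0, hχ1, hχin, hχout, hχlip⟩ := exists_cutoff z hρ hs
  -- ✓`graph_stability` on the finite graph `T` (as a type) with the cutoff `χ`
  have hG := graph_stability (B := ↥T) (fun b => b.1.1) (fun b => b.1.1 + unitVec b.1.2) u hu χ (fun a t => by
    have h := hmin χ hχout a t
    rw [← Finset.sum_coe_sort T] at h
    rw [← Finset.sum_coe_sort T] at h
    exact h)
  rw [Finset.sum_coe_sort T (fun b => χ b.1 * χ (b.1 + unitVec b.2) *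
      (dotProduct (u b.1 - u (b.1 + unitVec b.2)) (u b.1 - u (b.1 + unitVec b.2)) *
        (1 + dotProduct (u b.1 - u (b.1 + unitVec b.2)) (u b.1 - u (b.1 + unitVec b.2)) / 2))),
    Finset.sum_coe_sort T (fun b => dotProduct (u b.1) (u (b.1 + unitVec b.2)) * (χ b.1 - χ (b.1 + unitVec b.2)) ^ 2)] at hG
  -- nonnegativity of the energy terms
  have he0 : ∀ b : Zd d × Fin d, 0 ≤ dotProduct (u b.1 - u (b.1 + unitVec b.2)) (u b.1 - u (b.1 + unitVec b.2)) := fun b => by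
    simp only [dotProduct, Pi.sub_apply]
    exact Finset.sum_nonneg fun i _ => mul_self_nonneg _
  have hterm0 : ∀ b : Zd d × Fin d, 0 ≤ dotProduct (u b.1 - u (b.1 + unitVec b.2)) (u b.1 - u (b.1 + unitVec b.2)) *
      (1 + dotProduct (u b.1 - u (b.1 + unitVec b.2)) (u b.1 - u (b.1 + unitVec b.2)) / 2) := fun b =>
    mul_nonneg (he0 b) (by linarith [he0 b])
  -- LEFT: the bonds inside `Q_ρ(z)` carry `χ_x χ_y = 1`
  have hρ1 : box z ρ ⊆ box z (ρ + 1) := box_mono z (by linarith)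
  have hL : ∑ b ∈ T.filter (fun b => b.1 ∈ box z ρ ∧ b.1 + unitVec b.2 ∈ box z ρ),
      dotProduct (u b.1 - u (b.1 + unitVec b.2)) (u b.1 - u (b.1 + unitVec b.2)) *
        (1 + dotProduct (u b.1 - u (b.1 + unitVec b.2)) (u b.1 - u (b.1 + unitVec b.2)) / 2) ≤
      ∑ b ∈ T, χ b.1 * χ (b.1 + unitVec b.2) *
        (dotProduct (u b.1 - u (b.1 + unitVec b.2)) (u b.1 - u (b.1 + unitVec b.2)) *
          (1 + dotProduct (u b.1 - u (b.1 + unitVec b.2)) (u b.1 - u (b.1 + unitVec b.2)) / 2)) := by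
    calc ∑ b ∈ T.filter (fun b => b.1 ∈ box z ρ ∧ b.1 + unitVec b.2 ∈ box z ρ),
          dotProduct (u b.1 - u (b.1 + unitVec b.2)) (u b.1 - u (b.1 + unitVec b.2)) *
            (1 + dotProduct (u b.1 - u (b.1 + unitVec b.2)) (u b.1 - u (b.1 + unitVec b.2)) / 2)
        = ∑ b ∈ T.filter (fun b => b.1 ∈ box z ρ ∧ b.1 + unitVec b.2 ∈ box z ρ), χ b.1 * χ (b.1 + unitVec b.2) *
            (dotProduct (u b.1 - u (b.1 + unitVec b.2)) (u b.1 - u (b.1 + unitVec b.2)) *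
              (1 + dotProduct (u b.1 - u (b.1 + unitVec b.2)) (u b.1 - u (b.1 + unitVec b.2)) / 2)) := by
          refine Finset.sum_congr rfl fun b hb => ?_
          obtain ⟨_, hb1, hb2⟩ := Finset.mem_filter.1 hb
          rw [hχin _ (hρ1 hb1), hχin _ (hρ1 hb2), one_mul, one_mul]
      _ ≤ _ := by
          refine Finset.sum_le_sum_of_subset_of_nonneg (Finset.filter_subset _ T) fun b _ _ => ?_
          exact mul_nonneg (mul_nonneg (hχ0 _) (hχ0 _)) (hterm0 b)
  -- RIGHT: `c_b ≤ 1` and the cutoff's capacity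
  have hR : ∑ b ∈ T, dotProduct (u b.1) (u (b.1 + unitVec b.2)) * (χ b.1 - χ (b.1 + unitVec b.2)) ^ 2 ≤
      2 * (d : ℝ) * ((2 * (ρ + s) + 1 : ℤ) : ℝ) ^ d / (s : ℝ) ^ 2 :=
    sum_sq_sub_cutoff_le T z (by linarith) hs hχout hχlip (fun b => dotProduct (u b.1) (u (b.1 + unitVec b.2)))
      (fun b _ => dot_le_one (hu _) (hu _))
  calc _ ≤ _ := hL
    _ ≤ 3 * ∑ b ∈ T, dotProduct (u b.1) (u (b.1 + unitVec b.2)) * (χ b.1 - χ (b.1 + unitVec b.2)) ^ 2 := hG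
    _ ≤ 3 * (2 * (d : ℝ) * ((2 * (ρ + s) + 1 : ℤ) : ℝ) ^ d / (s : ℝ) ^ 2) := by linarith
    _ = 3 * (2 * (d : ℝ) * ((2 * (ρ + s) + 1 : ℤ) : ℝ) ^ d) / (s : ℝ) ^ 2 := by ring

/-- ★★ **The half-box form** (`ρ = s = R ≥ 1`): under minimality against variations supported in `Q_{2R}(z)`, the plain energy of the bonds inside
`Q_R(z)` is at most `6d(4R+1)^d ∕ R²` — the display `E(B_{R}) ≲ R^{d−2}` of the LOC-REG-MIN programme (`e_b ≤ e_b(1 + e_b∕2)`).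
[cite: Xin1980, p.609–613; Giaquinta1984, Ch. III §2 p.77] -/
theorem stability_caccioppoli_box_half (T : Finset (Zd d × Fin d)) (u : Zd d → Fin 4 → ℝ) (hu : ∀ x, dotProduct (u x) (u x) = 1)
    (z : Zd d) {R : ℤ} (hR : 1 ≤ R)
    (hmin : ∀ η : Zd d → ℝ, (∀ y ∉ box z (R + R), η y = 0) → ∀ (a : Fin 4) (t : ℝ),
      ∑ b ∈ T, dotProduct
        ((Real.sqrt (1 + t ^ 2 * dotProduct (η b.1 • (Pi.single a 1 - dotProduct (Pi.single a 1) (u b.1) • u b.1))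
            (η b.1 • (Pi.single a 1 - dotProduct (Pi.single a 1) (u b.1) • u b.1))))⁻¹ •
          (u b.1 + t • (η b.1 • (Pi.single a 1 - dotProduct (Pi.single a 1) (u b.1) • u b.1))))
        ((Real.sqrt (1 + t ^ 2 * dotProduct (η (b.1 + unitVec b.2) •
              (Pi.single a 1 - dotProduct (Pi.single a 1) (u (b.1 + unitVec b.2)) • u (b.1 + unitVec b.2)))
            (η (b.1 + unitVec b.2) • (Pi.single a 1 - dotProduct (Pi.single a 1) (u (b.1 + unitVec b.2)) • u (b.1 + unitVec b.2)))))⁻¹ •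
          (u (b.1 + unitVec b.2) + t • (η (b.1 + unitVec b.2) •
            (Pi.single a 1 - dotProduct (Pi.single a 1) (u (b.1 + unitVec b.2)) • u (b.1 + unitVec b.2))))) ≤
      ∑ b ∈ T, dotProduct (u b.1) (u (b.1 + unitVec b.2))) :
    ∑ b ∈ T.filter (fun b => b.1 ∈ box z R ∧ b.1 + unitVec b.2 ∈ box z R),
      dotProduct (u b.1 - u (b.1 + unitVec b.2)) (u b.1 - u (b.1 + unitVec b.2)) ≤
      6 * (d : ℝ) * ((4 * R + 1 : ℤ) : ℝ) ^ d / (R : ℝ) ^ 2 := by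
  classical
  have h := stability_caccioppoli_box T u hu z (ρ := R) (s := R) (by linarith) hR hmin
  have he0 : ∀ b : Zd d × Fin d, 0 ≤ dotProduct (u b.1 - u (b.1 + unitVec b.2)) (u b.1 - u (b.1 + unitVec b.2)) := fun b => by
    simp only [dotProduct, Pi.sub_apply]
    exact Finset.sum_nonneg fun i _ => mul_self_nonneg _
  have h1 : ∑ b ∈ T.filter (fun b => b.1 ∈ box z R ∧ b.1 + unitVec b.2 ∈ box z R),
      dotProduct (u b.1 - u (b.1 + unitVec b.2)) (u b.1 - u (b.1 + unitVec b.2)) ≤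
      ∑ b ∈ T.filter (fun b => b.1 ∈ box z R ∧ b.1 + unitVec b.2 ∈ box z R),
        dotProduct (u b.1 - u (b.1 + unitVec b.2)) (u b.1 - u (b.1 + unitVec b.2)) *
          (1 + dotProduct (u b.1 - u (b.1 + unitVec b.2)) (u b.1 - u (b.1 + unitVec b.2)) / 2) := by
    refine Finset.sum_le_sum fun b _ => ?_
    have := he0 b
    nlinarith
  have h2 : ((2 * (R + R) + 1 : ℤ) : ℝ) = ((4 * R + 1 : ℤ) : ℝ) := by push_cast; ring
  rw [h2] at h
  calc _ ≤ _ := h1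
    _ ≤ 3 * (2 * (d : ℝ) * ((4 * R + 1 : ℤ) : ℝ) ^ d) / (R : ℝ) ^ 2 := h
    _ = 6 * (d : ℝ) * ((4 * R + 1 : ℤ) : ℝ) ^ d / (R : ℝ) ^ 2 := by ring

end Summit.QuantumFields.YangMills.Theorems.PoincareLipschitzLeungXinBoxCaccioppoli
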